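import Summits.AnomalousDissipation.AnomalousDissipation.Theorems.SolenoidalFractalHomogenisationLagrangianStepW7AssemblyR
import Summits.AnomalousDissipation.AnomalousDissipation.Theorems.SolenoidalFractalHomogenisationLagrangianStepClassReductionFrame
import HarnessLib

/-!
# K1L_D (stmt-AnomalousDissipation-27980), registry v29 (C) — THE GRADED FROZEN-FRAME W7 PRODUCER `stub_W7thg` BY NAME

The registered stub of registry v29 (tenure planner ad-ideate-p1 g29, 2026-08-29T15:19:39Z; text D28-19′ (a)):
`stub_W7thg : ∀ M > 0, ∀ lo hi Λ β, 0 < lo → lo ≤ 1 → 1 ≤ hi → 1 < Λ → 0 ≤ β → ∀ Kb ≥ 1, ∃ CK ≥ 1, ∃ cK > 0, ∃ ν₀ > 0, ∃ θW > 0,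
HighLabelDecayWthg cubatureWord M hM lo hi Λ β ν₀ Kb CK cK θW` — the high-label exponential decay of the distorted cubature cell problem at EVERY
CONSTANT FRAME `G₀` with `|G₀ − 1| ≤ θ ≤ θW` (`…HighLabelDecayFrameDefs`, p726018), with `ν`- and frame-uniform constants.  It follows from TWO theorems:
`W7Cell.classDecayWθ_cubature_all` (`…W7AssemblyR`: the frozen-frame W7 engine — twisted three-mode hypocoercivity on the generic-damping slot step
`W7Slot.slot_stepR`, w1's frozen mode calculus `…CellChain*Frame`, the frame slack `θW = min (1/6) √(γ/4392)`) and the per-class reduction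
`classReductionFrame_of_pos` (`…ClassReductionFrame`: pair projection at a constant frame).  `ν₀ = 1`, `CK = e`.
Port plan B13 of `HOME/ad-sawtooth-k1loc-p1/g16/W7thg-portplan-k1locp1g16.md` (prover ad-sawtooth-k1loc-p1 g16).  No sorry.  NOT a proof of the crux
`LagrangianRenormalisationStepDesign` by itself (the registered stubs `stub_D1_V0thg`, `stub_Vmod_EHTthgw` remain open) nor of anomalous dissipation;
rung F-D1.A0. [cite: BedrossianCotiZelati2017, Thm 1.1 (enhanced dissipation; here: ν-uniform, frame-uniform Bloch-chain rate)] [problem: turb]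
-/

set_option linter.dupNamespace false

namespace Summit.AnomalousDissipation.AnomalousDissipation.Theorems.SolenoidalFractalHomogenisation.LagrangianStep

/-- **W7thg — THE GRADED FROZEN-FRAME HIGH-LABEL DECAY PRODUCER** (registered text of `stub_W7thg`, registry v29 (C), VERBATIM): from
`W7Cell.classDecayWθ_cubature_all` (`θW ≤ 1/6`, frame-uniform `cK`) and `classReductionFrame_of_pos` (`ν₀ = 1`, `CK = e`).
[cite: BedrossianCotiZelati2017, Thm 1.1] -/
theorem stub_W7thg : ∀ (M : ℝ) (hM : 0 < M) (lo hi Λ β : ℝ), 0 < lo → lo ≤ 1 → 1 ≤ hi → 1 < Λ → 0 ≤ β → ∀ Kb : ℝ, 1 ≤ Kb → ∃ CK : ℝ, 1 ≤ CK ∧ ∃ cK > (0:ℝ), ∃ ν₀ > (0:ℝ), ∃ θW > (0:ℝ), HighLabelDecayWthg Summit.AnomalousDissipation.AnomalousDissipation.Theorems.cubatureWord M hM lo hi Λ β ν₀ Kb CK cK θW := by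
  intro M hM lo hi Λ β hlo hlo1 hhi hΛ hβ Kb hKb
  obtain ⟨θW, hθW0, hθW6, cK, hcK, h⟩ := W7Cell.classDecayWθ_cubature_all M hM hlo hlo1 hhi hΛ hβ hKb
  exact ⟨Real.exp 1, Real.one_le_exp (by norm_num), cK, hcK, 1, one_pos, θW, hθW0,
    classReductionFrame_of_pos _ M hM lo hi Λ β 1 Kb (Real.exp 1) cK θW hlo hθW0.le (by linarith) h⟩

/-- The rung `θW = 0` re-derived: the flat high-label decay family of registry v28's `stub_highLabelDecay_IS` follows from `stub_W7thg` by
`highLabelDecayW_of_wthg` (`…HighLabelDecayFrameDefs`) — a consistency check, not used by the skeleton. [cite: BedrossianCotiZelati2017, Thm 1.1] -/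
theorem highLabelDecayW_cubature_of_W7thg (M : ℝ) (hM : 0 < M) (lo hi Λ β : ℝ) (hlo : 0 < lo) (hlo1 : lo ≤ 1) (hhi : 1 ≤ hi) (hΛ : 1 < Λ)
    (hβ : 0 ≤ β) (Kb : ℝ) (hKb : 1 ≤ Kb) :
    ∃ CK : ℝ, 1 ≤ CK ∧ ∃ cK > (0:ℝ), ∃ ν₀ > (0:ℝ),
      HighLabelDecayW Summit.AnomalousDissipation.AnomalousDissipation.Theorems.cubatureWord M hM lo hi Λ β ν₀ Kb CK cK := by
  obtain ⟨CK, hCK, cK, hcK, ν₀, hν₀, θW, hθW, h⟩ := stub_W7thg M hM lo hi Λ β hlo hlo1 hhi hΛ hβ Kb hKb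
  exact ⟨CK, hCK, cK, hcK, ν₀, hν₀, highLabelDecayW_of_wthg hθW.le h⟩

end Summit.AnomalousDissipation.AnomalousDissipation.Theorems.SolenoidalFractalHomogenisation.LagrangianStep
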